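import Literature.Algebra.Homology.ContCohomologyCrossedHomKernel
import Literature.AnabelianGeometry.AbsoluteAnabelian.AbsCuspCohomologyKerProofs
import Literature.AnabelianGeometry.AbsoluteAnabelian.AbsCuspCohomologyProofs
import HarnessLib

/-!
# [AbsCusp] Prop. 2.1 (ii), exactness at `H¹(Π_{U_S}, M_X)`: the (⇒) half by CUSP INDUCTION
# (proof-only companion of `AbsCuspCohomology.lean` / `AbsCuspCohomologyKerProofs.lean`)

S. Mochizuki, *Absolute anabelian cuspidalizations of proper hyperbolic curves*, J. Math. Kyoto Univ.
47 (2007), Prop. 2.1 (ii) p. 36 (lit key `paper:doi-10-1215-kjm-1250281022`): "restricting cohomology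
classes of `Π_{U_S}` to the various `I_x[U_S]`, for `x ∈ S`, yields a natural exact sequence
`1 → (k^×)^∧ → H¹(Π_{U_S}, M_X) → ⊕_{x∈S} Ẑ†`".  Typed (abc-iut-L4-t16) as `AbsCusp.Prop_2_1_ii_ker r q I`
(FACT-LIST F-0042): a class of `H¹(Π_{U_S}, M_X)` — extrinsic cyclotome `M_X = geomCyclotome q` for a
presentation `q : Π_{U_x} → Π_X`, action through `r : Π_{U_S} → Π_{U_x}` — dies on every `I_x` iff it
dies on `Δ_{U_S}`; model form `AbsCusp.Prop_2_1_ii_model` (F-0043).  abc-iut-f-054 REFUTED both universal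
closures, PROVED the (⇐) halves for all data and split the facts
(`prop_2_1_ii_ker_iff_forall_imp`, `prop_2_1_ii_model_iff_forall_imp`).

THIS FILE proves the (⇒) half — hence the named facts — AT EVERY PRESENTATION satisfying the
Prop. 1.4 (i)-shaped interface laws, by CUSP INDUCTION down to the ONE-CUSP presentation
`U_x ⊆ U_x ⊆ X` (`r = 𝟙`), using the generic crossed-homomorphism descent of
`Literature/Algebra/Homology/ContCohomologyCrossedHomKernel.lean`:

* inputs for `(r, q, I)`: `Π_{U_S} ↠ Π_{U_x}` surjective with kernel the closed normal subgroup generated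
  by (some of) the `I_s` ([AbsTopIII] Prop. 1.4 (i), second clause — the shape of
  `CurveModel.Prop_1_4_i'`, F-0340); inertia transport `I_x[U_x] ⊆ r(I_s)` for the cusps tested at the
  one-cusp level ([AbsTopIII] Prop. 1.4 (i), first clause / [AbsCusp] Prop. 1.5); `I_s ≤ Δ_{U_S}`;
* the ONE-CUSP case `AbsCusp.Prop_2_1_ii_ker (𝟙 Π_{U_x}) q I₀` as the residual binder (law (WT_x):
  «a class of `H¹(Π_{U_x}, M_X)` unramified at `x` is a Galois class» = print's exactness of
  `1 → (k^×)^∧ → H¹(Π_{U_x}, M_X) → Ẑ†`, whose print-world proof is the weight argument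
  `Hom_{G_k}(Δ_X^{ab}, M_X) = T(J_X)(k) = 0` over the local/Kummer-faithful base — the extrinsic
  cyclotome carries no `Π_X`-module structure in the tree (that is [AbsTopIII] Prop. 1.4 (ii), second
  half), so the induction stops at `U_x` rather than at `X`).

Mechanism: `η = [F]`; `F|_{I_s} = 0` (`Δ_{U_S}` acts trivially on `M_X`,
`geomCyclotomeRep_apply_of_mem_geom`); `F` kills the closed normal closure of the `I_s`, i.e.
`Ker(Π_{U_S} ↠ Π_{U_x})`; `F = F̄ ∘ r` with `F̄ : Π_{U_x} → M_X` a continuous crossed homomorphism for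
the one-cusp action; `F̄|_{I_x[U_x]} = 0` by transport; the one-cusp case gives `F̄|_{Δ_{U_x}} = 0`, hence
`F|_{Δ_{U_S}} = 0`.  Then the model form F-0043 from `CurveModel.Prop_1_4_i'` BY NAME + the transport
law + the one-cusp law at every cyclotome presentation.  All declarations are theorems; frozen files
untouched.  HONEST FRAMING: typed ≠ proved for genuine curves; laws are binders; nothing here bears on
[IUTchIII] Cor. 3.12.
-/

noncomputable section

open CategoryTheory Topology
open scoped Classical Pointwise IsMulCommutative

namespace Literature.AnabelianGeometry.AbsoluteAnabelian

namespace AbsCusp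

open AbsTopIII ContinuousCohomology

universe u

variable {E' E F : FundamentalExtension.{u}} (r : E' ⟶ E) (q : E ⟶ F)

/-- `M_X = geomCyclotome q` (inside the Hausdorff group `Π_{U_x}/[N, Δ]⁻`) is `T₁` — instance form
for the `Π_{U_S}`-module `geomCyclotomeTopRep r q` (L4-t16's `t1Space_geomCyclotome`).
[cite: MochizukiAbsCusp2007, Prop 2.1 p.35] -/
theorem t1Space_geomCyclotomeTopRep : T1Space (geomCyclotomeTopRep r q) :=
  t1Space_geomCyclotome q

/-- **Cusp induction for [AbsCusp] Prop. 2.1 (ii), (⇒) half.**  Let `r : Π_{U_S} → Π_{U_x}` be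
surjective with kernel the closed normal subgroup generated by the subgroups `I_s` (`s ∈ S₁`), all
`I_s ≤ Δ_{U_S}`; let `I₀ : S₀ → Subgroup Π_{U_x}` be subgroups of `Δ_{U_x}` covered by the images of
the `I_s` (inertia transport); and assume the ONE-CUSP exactness `Prop_2_1_ii_ker (𝟙 _) q I₀` for
`H¹(Π_{U_x}, M_X)`.  Then a class of `H¹(Π_{U_S}, M_X)` vanishing on every `I_s` vanishes on `Δ_{U_S}`.
[cite: MochizukiAbsCusp2007, Prop 2.1 (ii) p.36] -/
theorem prop_2_1_ii_mp_of_oneCusp (hsurj : Function.Surjective r.arith)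
    {S : Type u} (I : S → Subgroup E'.arith) (hI : ∀ s, I s ≤ E'.geom) {S₁ : Set S}
    (hker : r.arith.toMonoidHom.ker =
      (Subgroup.normalClosure (⋃ s ∈ S₁, (I s : Set E'.arith))).topologicalClosure)
    {S₀ : Type u} (I₀ : S₀ → Subgroup E.arith)
    (htr : ∀ s₀, ∀ g ∈ I₀ s₀, ∃ s, ∃ g' ∈ I s, r.arith g' = g)
    (h1 : Literature.AnabelianGeometry.AbsoluteAnabelian.AbsCusp.Prop_2_1_ii_ker (𝟙 E) q I₀)
    (c : geomCyclotomeH1 r q) (hc : ∀ s, geomCyclotomeH1Res r q (I s) c = 0) :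
    geomCyclotomeH1Res r q E'.geom c = 0 := by
  haveI : T1Space (geomCyclotomeTopRep r q) := t1Space_geomCyclotomeTopRep r q
  haveI : T1Space (geomCyclotomeTopRep (𝟙 E) q) := t1Space_geomCyclotomeTopRep (𝟙 E) q
  obtain ⟨F, hF, rfl⟩ := exists_crossedHomClass_eq (geomCyclotomeTopRep r q) c
  -- `F` vanishes on each `I_s`
  have hFI : ∀ s, ∀ i ∈ I s, F i = 0 := by
    intro s i hi
    exact apply_eq_zero_of_map_crossedHomClass_eq_zero _
      (subgroupInclusion (I s)) (fun j y => geomCyclotomeRep_apply_of_mem_geom r q (hI s j.2) y)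
      F hF (hc s) ⟨i, hi⟩
  -- hence on `Ker(Π_{U_S} ↠ Π_{U_x})`
  have hFker : ∀ g, r.arith g = 1 → F g = 0 := by
    intro g hg
    have hg' : g ∈ (Subgroup.normalClosure (⋃ s ∈ S₁, (I s : Set E'.arith))).topologicalClosure := by
      rw [← hker]
      exact hg
    refine apply_eq_zero_of_mem_closure_normalClosure (geomCyclotomeTopRep r q) E'.geom
      E'.isClosed_geom (fun n hn y => geomCyclotomeRep_apply_of_mem_geom r q hn y) F hF ?_ ?_ hg'
    · intro t ht
      obtain ⟨s, -, hts⟩ := Set.mem_iUnion₂.1 ht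
      exact hI s hts
    · intro t ht
      obtain ⟨s, -, hts⟩ := Set.mem_iUnion₂.1 ht
      exact hFI s t hts
  -- descend to `Π_{U_x}`: `F = F̄ ∘ r` for a crossed homomorphism `F̄` of the one-cusp module
  have hF' : ∀ a b, F (a * b) = F a + (geomCyclotomeTopRep (𝟙 E) q).ρ (r.arith a) (F b) := by
    intro a b
    rw [hF]
    rfl
  obtain ⟨Fb, hFb, hFbF⟩ := crossedHom_descends_of_surjective r.arith hsurj
    (geomCyclotomeTopRep (𝟙 E) q) (show C(E'.arith, Additive (geomCyclotome q)) from F) hF' hFker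
  -- `F̄` vanishes on every `I₀ s₀` (inertia transport)
  have hFbI₀ : ∀ s₀, ∀ g ∈ I₀ s₀, Fb g = 0 := by
    intro s₀ g hg
    obtain ⟨s, g', hg', rfl⟩ := htr s₀ g hg
    rw [hFbF]
    exact hFI s g' hg'
  -- the one-cusp case: `[F̄]` dies on every `I₀ s₀`, hence on `Δ_{U_x}`, hence `F̄|_{Δ_{U_x}} = 0`
  have hres : ∀ s₀, geomCyclotomeH1Res (𝟙 E) q (I₀ s₀) (crossedHomClass _ Fb hFb) = 0 :=
    fun s₀ => map_crossedHomClass_eq_zero_of_apply_eq_zero _ (subgroupInclusion (I₀ s₀)) Fb hFb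
      fun g => hFbI₀ s₀ g g.2
  have hgeom := (h1 _).1 hres
  have hFbΔ : ∀ d ∈ E.geom, Fb d = 0 := fun d hd =>
    apply_eq_zero_of_map_crossedHomClass_eq_zero _
      (subgroupInclusion E.geom) (fun j y => geomCyclotomeRep_apply_of_mem_geom (𝟙 E) q j.2 y)
      Fb hFb hgeom ⟨d, hd⟩
  -- conclude: `F|_{Δ_{U_S}} = 0`
  have hFΔ : ∀ d ∈ E'.geom, F d = 0 := fun d hd => by
    rw [← hFbF d]
    exact hFbΔ _ (r.mapsTo_geom hd)
  exact map_crossedHomClass_eq_zero_of_apply_eq_zero _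
    (subgroupInclusion E'.geom) F hF fun d => hFΔ d d.2

/-- **F-0042 `Prop_2_1_ii_ker r q I` at every presentation from the Prop. 1.4 (i)-shaped inputs and the
ONE-CUSP case** (assembled with f-054's (⇐) half through `prop_2_1_ii_ker_iff_forall_imp`).
[cite: MochizukiAbsCusp2007, Prop 2.1 (ii) p.36] -/
theorem prop_2_1_ii_ker_of_oneCusp (hsurj : Function.Surjective r.arith)
    {S : Type u} (I : S → Subgroup E'.arith) (hI : ∀ s, I s ≤ E'.geom) {S₁ : Set S}
    (hker : r.arith.toMonoidHom.ker =
      (Subgroup.normalClosure (⋃ s ∈ S₁, (I s : Set E'.arith))).topologicalClosure)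
    {S₀ : Type u} (I₀ : S₀ → Subgroup E.arith)
    (htr : ∀ s₀, ∀ g ∈ I₀ s₀, ∃ s, ∃ g' ∈ I s, r.arith g' = g)
    (h1 : Literature.AnabelianGeometry.AbsoluteAnabelian.AbsCusp.Prop_2_1_ii_ker (𝟙 E) q I₀) :
    Literature.AnabelianGeometry.AbsoluteAnabelian.AbsCusp.Prop_2_1_ii_ker r q I :=
  (prop_2_1_ii_ker_iff_forall_imp r q I hI).2 fun c hc =>
    prop_2_1_ii_mp_of_oneCusp r q hsurj I hI hker I₀ htr h1 c hc

/-- **F-0043 `Prop_2_1_ii_model M` at every `CurveModel` from [AbsTopIII] Prop. 1.4 (i) BY NAME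
(`M.Prop_1_4_i'`, F-0340), the inertia-transport law (TR) and the one-cusp law (WT_x)** — for every
presentation `U_S ⊆ U_x ⊆ X` with `(U_x, x)` a cyclotome presentation over an MLF: (TR) «the inertia
group of `x` in `Π_{U_x}` is covered by the image of a cuspidal inertia group of `U_S`» ([AbsTopIII]
Prop. 1.4 (i) / [AbsCusp] Prop. 1.5, true at the étale-`π₁` model) and (WT_x) «one-cusp exactness:
a class of `H¹(Π_{U_x}, M_X)` unramified at `x` is a Galois class» (print p. 36 at `S = {x}`; weights),
both carried as binders. [cite: MochizukiAbsCusp2007, Prop 2.1 (ii) p.36] -/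
theorem prop_2_1_ii_model_of_prop_1_4_i'_of_oneCusp (M : CurveModel.{u}) (h14 : M.Prop_1_4_i')
    (htr : ∀ (US Ux X : M.Curve) (h₁ : M.IsCofiniteOpen US Ux) (h₂ : M.IsCofiniteOpen Ux X)
      (x : (M.cusps Ux).Cusp), M.IsScheme US → M.IsCyclotomePresentation h₂ x →
      ∀ g ∈ (M.cusps Ux).Icusp x, ∃ s : (M.cusps US).Cusp, ∃ g' ∈ (M.cusps US).Icusp s,
        (M.res h₁).arith g' = g)
    (h1 : ∀ (Ux X : M.Curve) (h₂ : M.IsCofiniteOpen Ux X) (x : (M.cusps Ux).Cusp),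
      M.IsCyclotomePresentation h₂ x → IsMLF (M.base X) →
      Literature.AnabelianGeometry.AbsoluteAnabelian.AbsCusp.Prop_2_1_ii_ker (𝟙 (M.ext Ux)) (M.res h₂)
        (fun _ : PUnit.{u + 1} => (M.cusps Ux).Icusp x)) :
    Literature.AnabelianGeometry.AbsoluteAnabelian.AbsCusp.Prop_2_1_ii_model M := by
  rw [prop_2_1_ii_model_iff_forall_imp]
  intro US Ux X h₁ h₂ x hUS hpres hk _hrat c hc
  obtain ⟨hsurj, -, S₁, hker⟩ := h14 US Ux h₁ hUS hpres.isScheme.1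
  exact prop_2_1_ii_mp_of_oneCusp (M.res h₁) (M.res h₂) hsurj
    (fun y : (M.cusps US).Cusp => (M.cusps US).Icusp y) (fun y => (M.cusps US).Icusp_le_geom y) hker
    (fun _ : PUnit.{u + 1} => (M.cusps Ux).Icusp x)
    (fun _ g hg => htr US Ux X h₁ h₂ x hUS hpres g hg) (h1 Ux X h₂ x hpres hk) c hc

end AbsCusp

end Literature.AnabelianGeometry.AbsoluteAnabelian
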